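import Mathlib.Analysis.SpecialFunctions.Pow.Real
import Mathlib.Analysis.SpecialFunctions.Sqrt
import Mathlib.Analysis.SpecificLimits.Basic
import Mathlib.Algebra.BigOperators.Group.Finset.Basic
import Mathlib.Algebra.Order.BigOperators.Group.Finset
import Mathlib.Analysis.SpecialFunctions.Log.Base
import Mathlib.Tactic.NormNum
import Mathlib.Tactic.Linarith
import Mathlib.Tactic.Positivity
import Mathlib.Tactic.FieldSimp
import Mathlib.Tactic.Ring
import HarnessLib

/-!
# Volkov's Monte-Carlo error model σ↑/σ↓ (PRD 98, 076018 (2018) §IV.F "Monte Carlo error estimation") — the printed formulas typed verbatim, with the printed side-claims PROVED: the least-squares footnote (the coefficients `a^l_j`, `f^l_j` do minimise `Σ (kj + b − x_j)²`), the square-root footnote (`x = n + C²/2 ± C√(n + C²/4)` solves `x ∓ C√x = n`), the geometric-tail reading of `Δ_peak`, the two-sided bound behind "w ∼ k − 2 as k → +∞ and w → 1/8 as k → −∞", and the heavy-tail sentence "if p_{j+1}/p_j < 4 for all j < j₀ then the standard deviation is infinite" (likewise `< 8` for the third moment)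

independent recomputation; certified where stated, statistical where stated; no new-physics claim.

CITATION HEADER (venture `QEDPrecision`, cell `pub-qed`; literature seat gen 21; VALUE-FREE: formulas and the algorithm's own numerical
CONSTANTS only — no Monte-Carlo value, no table entry, nothing per graph / per family). The cell's second implementation uses this section verbatim
(`code/int2/v1.8.2/errmodel.py`, HOME `pub-qed-int-2/SCHEME-NOTES.md` C8: "What he prints as σ is NOT σ̂/√N of a CLT estimator but his two-sided error
model σ↑/σ↓"); the IR/SE lane's diagnostics (`irse/SEATS.md` rule 4, strand (c)) compare their Hill / growth-law tail indices with it.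
Source: [Volkov2018] S. Volkov, "Numerical calculation of high-order QED contributions to the electron anomalous magnetic moment", Phys. Rev. D 98,
076018 (2018) = arXiv:1807.05281v2, §IV.F "Monte Carlo error estimation" (LaTeX e-print held by the cell, HOME
`data/lit/sources/.cache/1807.05281/amm4gpu_arxiv.tex`, l.1044–1196; corpus copy `paper-arxiv-1807.05281` chunk p0011:L113 – p0012). VERBATIM:
"Let z₁,…,z_N be random samples … By definition, put y_j = I(z)/g(z). The conventional error estimation approach is based on the following
formula for the standard deviation: (σ↓)² = Σ_{j=1}^{N} y_j²/N² − (Σ_{j=1}^{N} y_j)²/N³. However, this formula has a tendency to underestimate the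
real standard deviation. … By definition, put maxlog = max_j ⌊log₂|y_j| + 0.5⌋, let n_k be the quantity of samples j such that (eq_n_prob_def)
2^{maxlog−k−0.5} ≤ |y_j| < 2^{maxlog−k+0.5}. … n_k is an approximation for N p_k, where p_k is the probability that a sample is in the interval
(eq_n_prob_def). We can see that the real standard deviation is highly dependent on the behavior of p_j for j < 0. For example, if p_{j+1}/p_j < 4
for all j < j₀ then the standard deviation is infinite" (l.1049–1077; footnote l.1079–1089: "the Berry-Esseen inequality uses the third central
moment of random variables that is infinite if p_{j+1}/p_j < 8 for all j < j₀") · "We will use the improved estimation (σ↑)² = (σ↓)² + Δ_uncert +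
Δ_peak, where Δ_uncert = 4 · max_{k=0}^{19} 4^{maxlog−k} √n_k is the contribution of the uncertainty of n_k, Δ_peak is the contribution of the
predicted behavior of p_j for j < 0" (l.1090–1100; footnote l.1101–1107: "It should not be treated as a universal procedure that works for all
Monte Carlo integrations. However, a big value of σ↑/σ↓ indicates that the obtained error estimation is unreliable.") · "h_j = log₂ n_j, if n_j > 0;
−2, if n_j = 0", "h_j^± = log₂ max(1/8, n_j + 1/2 ± √(n_j + 1/4))" (l.1113–1120) with footnote "x = n + C²/2 ± C√(n + C²/4) is the solution of the
equation x ∓ C√x = n" (l.1121–1125) · "d = max_{0≤j<k≤18} d_{jk}/(k−j), where d_{jk} is the distance from 0 to the interval [d⁻_{jk}; d⁺_{jk}],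
d⁻_{jk} = (h⁻_{k+1} − h⁺_k) − (h⁺_{j+1} − h⁻_j), d⁺_{jk} = (h⁺_{k+1} − h⁻_k) − (h⁻_{j+1} − h⁺_j)" (l.1127–1137) · "u_j = ½[log₂(n_j + C_j²/2 +
C_j√(n_j + C_j²/4)) − log₂(n_j + C_j²/2 − C_j√(n_j + C_j²/4))], if n_j > 0; 3, if n_j = 0, where C_j = 2/(1 + 2(j+1)/20)" (l.1139–1152) · "For
approximating the sequence of logarithms by a linear function kj + b let us introduce coefficients a^l_j, f^l_j, 2 ≤ l ≤ 20, 0 ≤ j < l, for the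
least squares method [footnote: The explitit [sic] formulas are a^l_j = (12j − 6(l−1))/(l(l²−1)), f^l_j = (2(2l−1) − 6j)/(l(l+1)).]:
(Σ_{j=0}^{l−1} a^l_j x_j; Σ_{j=0}^{l−1} f^l_j x_j) = argmin_{(k;b)} Σ_{j=0}^{l−1} (kj + b − x_j)² for all l and x₀,…,x_{l−1}." (l.1153–1162) · "k_l =
Σ a^l_j h_j − √(Σ (a^l_j)² u_j²) − d Σ j(j−1)a^l_j/2, k = max(k₂,…,k₂₀, h₀ − 1 − u₀)", "Δb = min_l (√(Σ (f^l_j)² u_j²) + d Σ j(j−1) f^l_j/2),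
b = Σ f^l_j h_j, where we take l for which the minimum is achieved. Let us define Δ_peak by Δ_peak = 2^{2·maxlog + b + 0.7Δb} (1/(1 − 2^{−w}) − 1),
where w = (k − 17/8 + √((k − 17/8)² + 1/16))/2 + 1/8. The meaning of this definition is that we use the formula for the sum of a geometric
progression taking w instead of k − 2. w is defined in such a way that w ∼ k − 2 as k → +∞ and w → 1/8 as k → −∞. We use σ↑ for all numerical
results that are presented in this paper." (l.1164–1196).

What is typed (`noncomputable def`s on real inputs) and what the kernel certifies:
* `sigmaDownSq` (σ↓² as printed) and `sigmaDownSq_eq_var`: σ↓² = (1/N²) Σ_j (y_j − ȳ)² — the printed expression is the (biased) sample variance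
  of the mean, hence `sigmaDownSq_nonneg`.
* `aCoef l j`, `fCoef l j` (the footnote's a^l_j, f^l_j); `aCoef_normal₁/₂` (the two normal-equation identities per index, `field_simp; ring`);
  private helpers `sum_range_id_real`, `sum_range_sq_real` (Σ_{j<l} j = l(l−1)/2, Σ_{j<l} j² = (l−1)l(2l−1)/6); and **`leastSquares_footnote`: for every l ≥ 2 and
  every data x₀…x_{l−1}, the printed (k*, b*) = (Σ a^l_j x_j, Σ f^l_j x_j) satisfies Σ (kj + b − x_j)² ≥ Σ (k*j + b* − x_j)² for ALL (k, b)** — the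
  printed "argmin" claim, proved (orthogonality of the residuals to 1 and j, then a sum of squares).
* `sqrtFootnote`: for n ≥ 0, C ≥ 0, x± = n + C²/2 ± C√(n + C²/4) satisfy x₊ − C√x₊ = n and x₋ + C√x₋ = n (so h⁺_j/h⁻_j and u_j are the log₂ of the
  roots of n_j = x ∓ C√x with C = 1 resp. C = C_j); `cCoef j` = C_j with `cCoef_ends : C₀ = 20/11 ∧ C₁₉ = 2/3` and `cCoef_strictAnti` (it decreases
  from ≈ 1.82 to 2/3 across the twenty bins — arithmetic of the printed formula); `hPM`, `uOf`, `deltaUncert`, `sigmaUpSq` as printed.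
* `wOf k` (the printed w) and **`wOf_bounds`: max(1/8, k − 2) < w ≤ max(1/8, k − 2) + 1/8** — the printed asymptotic sentence made quantitative
  (in particular w > 0 always, so 2^{−w} < 1 and the geometric formula below applies); `deltaPeak` as printed; **`geometric_tail`: for w > 0,
  Σ_{i≥1} (2^{−w})^i = 1/(1 − 2^{−w}) − 1** ("we use the formula for the sum of a geometric progression").
* **`not_summable_of_ratio_lt`**: if q₀ > 0 and q_{n} < c·q_{n+1} for all n (octave probabilities decaying slower than a factor 1/c per octave towards
  large |y|), then Σ_n q_n cⁿ diverges; with c = 4 (`variance_infinite_of_ratio_lt_four`) this is the printed sentence "if p_{j+1}/p_j < 4 for all j < j₀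
  then the standard deviation is infinite" in the octave model (second moment ≥ Σ_k p_k 4^{maxlog−k−1/2}), and with c = 8 the Berry–Esseen footnote
  (third absolute moment).
NOT typed: the data-flow maxima/minima over l (k = max(k₂,…,k₂₀,h₀−1−u₀), Δb = min_l …) are stated in the docstrings only; nothing is claimed about
the statistical validity of σ↑ (the paper itself: "It should not be treated as a universal procedure").
-/

namespace Literature.MathematicalPhysics.QuantumFieldTheory.Volkov2018

open Finset

noncomputable section

/-! ## σ↓ — the conventional estimate -/

/-- "(σ↓)² = Σ_{j=1}^{N} y_j²/N² − (Σ_{j=1}^{N} y_j)²/N³" for samples y₀ … y_{N−1} of I/g. [cite: Volkov2018, §IV.F (σ↓ display)] -/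
def sigmaDownSq (N : ℕ) (y : ℕ → ℝ) : ℝ :=
  (∑ j ∈ range N, y j ^ 2) / (N : ℝ) ^ 2 - (∑ j ∈ range N, y j) ^ 2 / (N : ℝ) ^ 3

/-- σ↓² is the 1/N-normalised sample variance divided by N: (σ↓)² = (1/N²)·Σ_j (y_j − ȳ)², ȳ = (Σ y_j)/N (N ≥ 1). [cite: Volkov2018, §IV.F] -/
theorem sigmaDownSq_eq_var (N : ℕ) (hN : 0 < N) (y : ℕ → ℝ) :
    sigmaDownSq N y = (∑ j ∈ range N, (y j - (∑ i ∈ range N, y i) / N) ^ 2) / (N : ℝ) ^ 2 := by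
  unfold sigmaDownSq
  have hN' : (N : ℝ) ≠ 0 := by exact_mod_cast hN.ne'
  have expand : ∑ j ∈ range N, (y j - (∑ i ∈ range N, y i) / N) ^ 2 =
      ∑ j ∈ range N, y j ^ 2 - (∑ i ∈ range N, y i) ^ 2 / N := by
    have h1 : ∑ j ∈ range N, (y j - (∑ i ∈ range N, y i) / N) ^ 2 =
        ∑ j ∈ range N, (y j ^ 2 - 2 * ((∑ i ∈ range N, y i) / N) * y j + ((∑ i ∈ range N, y i) / N) ^ 2) := by
      apply sum_congr rfl; intro j _; ring
    rw [h1, sum_add_distrib, sum_sub_distrib, ← mul_sum, sum_const, card_range]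
    simp only [nsmul_eq_mul]
    field_simp
    ring
  rw [expand]
  field_simp

/-- Hence σ↓² ≥ 0. [cite: Volkov2018, §IV.F] -/
theorem sigmaDownSq_nonneg (N : ℕ) (hN : 0 < N) (y : ℕ → ℝ) : 0 ≤ sigmaDownSq N y := by
  rw [sigmaDownSq_eq_var N hN y]
  apply div_nonneg (sum_nonneg fun j _ => sq_nonneg _) (by positivity)

/-! ## The least-squares footnote -/

/-- "a^l_j = (12j − 6(l−1))/(l(l²−1))" — the slope coefficients of the least-squares line through (j, x_j), j = 0…l−1.
[cite: Volkov2018, §IV.F footnote (explicit formulas)] -/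
def aCoef (l : ℕ) (j : ℕ) : ℝ := (12 * (j : ℝ) - 6 * ((l : ℝ) - 1)) / ((l : ℝ) * ((l : ℝ) ^ 2 - 1))

/-- "f^l_j = (2(2l−1) − 6j)/(l(l+1))" — the intercept coefficients. [cite: Volkov2018, §IV.F footnote (explicit formulas)] -/
def fCoef (l : ℕ) (j : ℕ) : ℝ := (2 * (2 * (l : ℝ) - 1) - 6 * (j : ℝ)) / ((l : ℝ) * ((l : ℝ) + 1))

/-- Σ_{j<l} j = l(l−1)/2 over ℝ. [folklore] -/
private theorem sum_range_id_real (l : ℕ) : ∑ j ∈ range l, (j : ℝ) = (l : ℝ) * ((l : ℝ) - 1) / 2 := by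
  induction l with
  | zero => simp
  | succ n ih => rw [sum_range_succ, ih]; push_cast; ring

/-- Σ_{j<l} j² = (l−1)l(2l−1)/6 over ℝ. [folklore] -/
private theorem sum_range_sq_real (l : ℕ) : ∑ j ∈ range l, (j : ℝ) ^ 2 = ((l : ℝ) - 1) * (l : ℝ) * (2 * (l : ℝ) - 1) / 6 := by
  induction l with
  | zero => simp
  | succ n ih => rw [sum_range_succ, ih]; push_cast; ring

/-- First normal equation, per index: 1 − a^l_j · l(l−1)/2 − f^l_j · l = 0 (l ≥ 2). [cite: Volkov2018, §IV.F footnote] -/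
theorem aCoef_normal₁ (l : ℕ) (hl : 2 ≤ l) (j : ℕ) :
    1 - aCoef l j * ((l : ℝ) * ((l : ℝ) - 1) / 2) - fCoef l j * (l : ℝ) = 0 := by
  unfold aCoef fCoef
  have h2 : (2 : ℝ) ≤ (l : ℝ) := by exact_mod_cast hl
  have hl0 : (l : ℝ) ≠ 0 := by linarith
  have hl1 : (l : ℝ) - 1 ≠ 0 := by linarith
  have hl2 : (l : ℝ) + 1 ≠ 0 := by linarith
  have hl3 : (l : ℝ) ^ 2 - 1 ≠ 0 := by
    have : (l : ℝ) ^ 2 - 1 = ((l : ℝ) - 1) * ((l : ℝ) + 1) := by ring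
    rw [this]; exact mul_ne_zero hl1 hl2
  field_simp
  ring

/-- Second normal equation, per index: j − a^l_j · (l−1)l(2l−1)/6 − f^l_j · l(l−1)/2 = 0 (l ≥ 2). [cite: Volkov2018, §IV.F footnote] -/
theorem aCoef_normal₂ (l : ℕ) (hl : 2 ≤ l) (j : ℕ) :
    (j : ℝ) - aCoef l j * (((l : ℝ) - 1) * (l : ℝ) * (2 * (l : ℝ) - 1) / 6) - fCoef l j * ((l : ℝ) * ((l : ℝ) - 1) / 2) = 0 := by
  unfold aCoef fCoef
  have h2 : (2 : ℝ) ≤ (l : ℝ) := by exact_mod_cast hl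
  have hl0 : (l : ℝ) ≠ 0 := by linarith
  have hl1 : (l : ℝ) - 1 ≠ 0 := by linarith
  have hl2 : (l : ℝ) + 1 ≠ 0 := by linarith
  have hl3 : (l : ℝ) ^ 2 - 1 ≠ 0 := by
    have : (l : ℝ) ^ 2 - 1 = ((l : ℝ) - 1) * ((l : ℝ) + 1) := by ring
    rw [this]; exact mul_ne_zero hl1 hl2
  field_simp
  ring

/-- The printed least-squares slope `k* = Σ a^l_j x_j`. [cite: Volkov2018, §IV.F (argmin display)] -/
def kStar (l : ℕ) (x : ℕ → ℝ) : ℝ := ∑ j ∈ range l, aCoef l j * x j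

/-- The printed least-squares intercept `b* = Σ f^l_j x_j`. [cite: Volkov2018, §IV.F (argmin display)] -/
def bStar (l : ℕ) (x : ℕ → ℝ) : ℝ := ∑ j ∈ range l, fCoef l j * x j

/-- Orthogonality of the residuals to the constants: Σ_j (x_j − k*j − b*) = 0 (l ≥ 2). [cite: Volkov2018, §IV.F footnote] -/
theorem residual_sum_zero (l : ℕ) (hl : 2 ≤ l) (x : ℕ → ℝ) :
    ∑ j ∈ range l, (x j - kStar l x * (j : ℝ) - bStar l x) = 0 := by
  have goal : ∑ j ∈ range l, (x j - kStar l x * (j : ℝ) - bStar l x) =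
      ∑ j ∈ range l, x j - kStar l x * ((l : ℝ) * ((l : ℝ) - 1) / 2) - bStar l x * (l : ℝ) := by
    rw [sum_sub_distrib, sum_sub_distrib, ← mul_sum, sum_range_id_real, sum_const, card_range, nsmul_eq_mul]; ring
  have hsum : kStar l x * ((l : ℝ) * ((l : ℝ) - 1) / 2) + bStar l x * (l : ℝ) = ∑ i ∈ range l, x i := by
    unfold kStar bStar
    rw [sum_mul, sum_mul, ← sum_add_distrib]
    apply sum_congr rfl
    intro i _
    have h := aCoef_normal₁ l hl i
    have e : aCoef l i * x i * ((l : ℝ) * ((l : ℝ) - 1) / 2) + fCoef l i * x i * (l : ℝ) =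
        x i * (aCoef l i * ((l : ℝ) * ((l : ℝ) - 1) / 2) + fCoef l i * (l : ℝ)) := by ring
    have h' : aCoef l i * ((l : ℝ) * ((l : ℝ) - 1) / 2) + fCoef l i * (l : ℝ) = 1 := by linarith
    rw [e, h', mul_one]
  rw [goal]; linarith

/-- Orthogonality of the residuals to j: Σ_j j·(x_j − k*j − b*) = 0 (l ≥ 2). [cite: Volkov2018, §IV.F footnote] -/
theorem residual_sum_mul_id_zero (l : ℕ) (hl : 2 ≤ l) (x : ℕ → ℝ) :
    ∑ j ∈ range l, (j : ℝ) * (x j - kStar l x * (j : ℝ) - bStar l x) = 0 := by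
  have goal : ∑ j ∈ range l, (j : ℝ) * (x j - kStar l x * (j : ℝ) - bStar l x) =
      ∑ j ∈ range l, (j : ℝ) * x j - kStar l x * ∑ j ∈ range l, (j : ℝ) ^ 2 - bStar l x * ∑ j ∈ range l, (j : ℝ) := by
    rw [mul_sum, mul_sum, ← sum_sub_distrib, ← sum_sub_distrib]
    apply sum_congr rfl; intro j _; ring
  have hsum : kStar l x * (((l : ℝ) - 1) * (l : ℝ) * (2 * (l : ℝ) - 1) / 6) + bStar l x * ((l : ℝ) * ((l : ℝ) - 1) / 2) =
      ∑ i ∈ range l, (i : ℝ) * x i := by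
    unfold kStar bStar
    rw [sum_mul, sum_mul, ← sum_add_distrib]
    apply sum_congr rfl
    intro i _
    have h := aCoef_normal₂ l hl i
    have e : aCoef l i * x i * (((l : ℝ) - 1) * (l : ℝ) * (2 * (l : ℝ) - 1) / 6) + fCoef l i * x i * ((l : ℝ) * ((l : ℝ) - 1) / 2) =
        x i * (aCoef l i * (((l : ℝ) - 1) * (l : ℝ) * (2 * (l : ℝ) - 1) / 6) + fCoef l i * ((l : ℝ) * ((l : ℝ) - 1) / 2)) := by ring
    have h' : aCoef l i * (((l : ℝ) - 1) * (l : ℝ) * (2 * (l : ℝ) - 1) / 6) + fCoef l i * ((l : ℝ) * ((l : ℝ) - 1) / 2) = (i : ℝ) := by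
      linarith
    rw [e, h']; ring
  rw [goal, sum_range_sq_real, sum_range_id_real]; linarith

/-- **The footnote's claim, proved**: for every l ≥ 2 and data x₀ … x_{l−1}, the printed (Σ a^l_j x_j; Σ f^l_j x_j) minimises Σ_{j<l} (kj + b − x_j)² over
all (k, b). [cite: Volkov2018, §IV.F footnote "The explitit [sic] formulas are …" and the argmin display] -/
theorem leastSquares_footnote (l : ℕ) (hl : 2 ≤ l) (x : ℕ → ℝ) (k b : ℝ) :
    ∑ j ∈ range l, (kStar l x * (j : ℝ) + bStar l x - x j) ^ 2 ≤ ∑ j ∈ range l, (k * (j : ℝ) + b - x j) ^ 2 := by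
  have h1 := residual_sum_zero l hl x
  have h2 := residual_sum_mul_id_zero l hl x
  -- expand the competitor around the least-squares line
  have dec : ∑ j ∈ range l, (k * (j : ℝ) + b - x j) ^ 2 =
      ∑ j ∈ range l, (kStar l x * (j : ℝ) + bStar l x - x j) ^ 2
        + ∑ j ∈ range l, ((k - kStar l x) * (j : ℝ) + (b - bStar l x)) ^ 2
        - 2 * (k - kStar l x) * ∑ j ∈ range l, (j : ℝ) * (x j - kStar l x * (j : ℝ) - bStar l x)
        - 2 * (b - bStar l x) * ∑ j ∈ range l, (x j - kStar l x * (j : ℝ) - bStar l x) := by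
    rw [mul_sum, mul_sum, ← sum_add_distrib, ← sum_sub_distrib, ← sum_sub_distrib]
    apply sum_congr rfl; intro j _; ring
  rw [dec, h1, h2, mul_zero, mul_zero, sub_zero, sub_zero]
  have : 0 ≤ ∑ j ∈ range l, ((k - kStar l x) * (j : ℝ) + (b - bStar l x)) ^ 2 := sum_nonneg fun j _ => sq_nonneg _
  linarith

/-! ## The square-root footnote, h±_j, u_j, C_j -/

/-- Footnote: "x = n + C²/2 ± C√(n + C²/4) is the solution of the equation x ∓ C√x = n" — both branches, for n ≥ 0, C ≥ 0.
[cite: Volkov2018, §IV.F footnote (square-root equation)] -/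
theorem sqrtFootnote (n C : ℝ) (hn : 0 ≤ n) (hC : 0 ≤ C) :
    (n + C ^ 2 / 2 + C * Real.sqrt (n + C ^ 2 / 4)) - C * Real.sqrt (n + C ^ 2 / 2 + C * Real.sqrt (n + C ^ 2 / 4)) = n ∧
    (n + C ^ 2 / 2 - C * Real.sqrt (n + C ^ 2 / 4)) + C * Real.sqrt (n + C ^ 2 / 2 - C * Real.sqrt (n + C ^ 2 / 4)) = n := by
  set s := Real.sqrt (n + C ^ 2 / 4) with hs
  have hs2 : s ^ 2 = n + C ^ 2 / 4 := by rw [hs]; exact Real.sq_sqrt (by positivity)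
  have hs0 : 0 ≤ s := Real.sqrt_nonneg _
  have hsC : C / 2 ≤ s := by
    rw [hs, show C / 2 = Real.sqrt ((C / 2) ^ 2) from (Real.sqrt_sq (by positivity)).symm]
    exact Real.sqrt_le_sqrt (by nlinarith)
  have hplus : n + C ^ 2 / 2 + C * s = (s + C / 2) ^ 2 := by nlinarith
  have hminus : n + C ^ 2 / 2 - C * s = (s - C / 2) ^ 2 := by nlinarith
  have r1 : Real.sqrt (n + C ^ 2 / 2 + C * s) = s + C / 2 := by rw [hplus]; exact Real.sqrt_sq (by linarith)
  have r2 : Real.sqrt (n + C ^ 2 / 2 - C * s) = s - C / 2 := by rw [hminus]; exact Real.sqrt_sq (by linarith)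
  rw [r1, r2]
  constructor <;> nlinarith

/-- "C_j = 2/(1 + 2(j+1)/20)" — the confidence multiplier used in u_j. [cite: Volkov2018, §IV.F (u_j display)] -/
def cCoef (j : ℕ) : ℝ := 2 / (1 + 2 * ((j : ℝ) + 1) / 20)

/-- C₀ = 20/11 (≈ 1.82) and C₁₉ = 2/3: the multiplier decreases across the twenty bins j = 0 … 19 (printed-formula arithmetic).
[cite: Volkov2018, §IV.F (u_j display)] -/
theorem cCoef_ends : cCoef 0 = 20 / 11 ∧ cCoef 19 = 2 / 3 := by
  unfold cCoef; constructor <;> norm_num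

/-- C_j is strictly decreasing in j ("errors for lesser j are more critical"). [cite: Volkov2018, §IV.F (u_j display)] -/
theorem cCoef_strictAnti (i j : ℕ) (h : i < j) : cCoef j < cCoef i := by
  unfold cCoef
  have hij : (i : ℝ) < (j : ℝ) := by exact_mod_cast h
  apply div_lt_div_of_pos_left (by norm_num) (by positivity) (by linarith)

/-- "h_j^± = log₂ max(1/8, n_j + 1/2 ± √(n_j + 1/4))" (the C = 1 roots of n_j = x ∓ √x, floored at 1/8). [cite: Volkov2018, §IV.F (h^± display)] -/
def hPM (sgn : ℝ) (n : ℝ) : ℝ := Real.logb 2 (max (1 / 8) (n + 1 / 2 + sgn * Real.sqrt (n + 1 / 4)))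

/-- "u_j = ½[log₂(n_j + C_j²/2 + C_j√(n_j + C_j²/4)) − log₂(n_j + C_j²/2 − C_j√(n_j + C_j²/4))], if n_j > 0; 3, if n_j = 0".
[cite: Volkov2018, §IV.F (u_j display)] -/
def uOf (j : ℕ) (n : ℝ) : ℝ :=
  if n > 0 then
    (1 / 2) * (Real.logb 2 (n + cCoef j ^ 2 / 2 + cCoef j * Real.sqrt (n + cCoef j ^ 2 / 4))
      - Real.logb 2 (n + cCoef j ^ 2 / 2 - cCoef j * Real.sqrt (n + cCoef j ^ 2 / 4)))
  else 3

/-! ## Δ_uncert, w, Δ_peak and the geometric tail -/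

/-- "Δ_uncert = 4 · max_{k=0}^{19} 4^{maxlog−k} √n_k" (bin counts n₀ … n₁₉, maxlog an integer). [cite: Volkov2018, §IV.F (Δ_uncert display)] -/
def deltaUncert (maxlog : ℤ) (n : ℕ → ℝ) : ℝ :=
  4 * (range 20).sup' (by simp) fun k => (4 : ℝ) ^ (maxlog - k) * Real.sqrt (n k)

/-- "w = (k − 17/8 + √((k − 17/8)² + 1/16))/2 + 1/8". [cite: Volkov2018, §IV.F (w display)] -/
def wOf (k : ℝ) : ℝ := (k - 17 / 8 + Real.sqrt ((k - 17 / 8) ^ 2 + 1 / 16)) / 2 + 1 / 8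

/-- `√(u² + 1/16) − |u| ∈ (0, 1/4]`. [folklore] -/
private theorem sqrt_sq_add_sixteenth_bounds (u : ℝ) :
    |u| < Real.sqrt (u ^ 2 + 1 / 16) ∧ Real.sqrt (u ^ 2 + 1 / 16) ≤ |u| + 1 / 4 := by
  constructor
  · rw [← Real.sqrt_sq_eq_abs u]
    exact Real.sqrt_lt_sqrt (sq_nonneg u) (by linarith)
  · have h2 : Real.sqrt ((|u| + 1 / 4) ^ 2) = |u| + 1 / 4 := Real.sqrt_sq (by positivity)
    rw [← h2]
    apply Real.sqrt_le_sqrt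
    have h3 : (|u| + 1 / 4) ^ 2 = u ^ 2 + |u| / 2 + 1 / 16 := by rw [add_sq, sq_abs]; ring
    rw [h3]; have := abs_nonneg u; linarith

/-- The printed sentence "w ∼ k − 2 as k → +∞ and w → 1/8 as k → −∞", quantified: **max(1/8, k − 2) < w ≤ max(1/8, k − 2) + 1/8** for every k.
In particular w > 1/8 > 0. [cite: Volkov2018, §IV.F (sentence after the w display)] -/
theorem wOf_bounds (k : ℝ) : max (1 / 8) (k - 2) < wOf k ∧ wOf k ≤ max (1 / 8) (k - 2) + 1 / 8 := by
  obtain ⟨hl, hu⟩ := sqrt_sq_add_sixteenth_bounds (k - 17 / 8)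
  unfold wOf
  rcases le_or_gt (17 / 8) k with hk | hk
  · rw [abs_of_nonneg (by linarith : (0:ℝ) ≤ k - 17 / 8)] at hl hu
    rw [max_eq_right (by linarith : (1:ℝ) / 8 ≤ k - 2)]
    constructor <;> linarith
  · rw [abs_of_neg (by linarith : k - 17 / 8 < 0)] at hl hu
    rw [max_eq_left (by linarith : k - 2 ≤ (1:ℝ) / 8)]
    constructor <;> linarith

/-- w > 0, so 0 < 2^{−w} < 1. [cite: Volkov2018, §IV.F] -/
theorem wOf_pos (k : ℝ) : 0 < wOf k := by
  have := (wOf_bounds k).1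
  have h8 : (1:ℝ) / 8 ≤ max (1 / 8) (k - 2) := le_max_left _ _
  linarith

/-- "Δ_peak = 2^{2·maxlog + b + 0.7Δb} (1/(1 − 2^{−w}) − 1)". [cite: Volkov2018, §IV.F (Δ_peak display)] -/
def deltaPeak (maxlog : ℤ) (b db w : ℝ) : ℝ :=
  (2 : ℝ) ^ (2 * (maxlog : ℝ) + b + 0.7 * db) * (1 / (1 - (2 : ℝ) ^ (-w)) - 1)

/-- "(σ↑)² = (σ↓)² + Δ_uncert + Δ_peak". [cite: Volkov2018, §IV.F (σ↑ display)] -/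
def sigmaUpSq (sDown2 dUncert dPeak : ℝ) : ℝ := sDown2 + dUncert + dPeak

/-- "The meaning of this definition is that we use the formula for the sum of a geometric progression taking w instead of k − 2": for w > 0 the
ratio r = 2^{−w} lies in (0, 1) and Σ_{i≥1} r^i = 1/(1 − r) − 1. [cite: Volkov2018, §IV.F (sentence after the Δ_peak display)] -/
theorem geometric_tail (w : ℝ) (hw : 0 < w) :
    0 < (2 : ℝ) ^ (-w) ∧ (2 : ℝ) ^ (-w) < 1 ∧
    HasSum (fun i : ℕ => ((2 : ℝ) ^ (-w)) ^ (i + 1)) (1 / (1 - (2 : ℝ) ^ (-w)) - 1) := by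
  have hr0 : 0 < (2 : ℝ) ^ (-w) := Real.rpow_pos_of_pos (by norm_num) _
  have hr1 : (2 : ℝ) ^ (-w) < 1 := Real.rpow_lt_one_of_one_lt_of_neg (by norm_num) (by linarith)
  refine ⟨hr0, hr1, ?_⟩
  have hg := hasSum_geometric_of_lt_one hr0.le hr1
  have hg' := hg.mul_left ((2 : ℝ) ^ (-w))
  have hne : (1 : ℝ) - (2 : ℝ) ^ (-w) ≠ 0 := by linarith
  have hval : (2 : ℝ) ^ (-w) * (1 - (2 : ℝ) ^ (-w))⁻¹ = 1 / (1 - (2 : ℝ) ^ (-w)) - 1 := by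
    field_simp; ring
  have hfun : (fun i : ℕ => ((2 : ℝ) ^ (-w)) ^ (i + 1)) = fun i => (2 : ℝ) ^ (-w) * ((2 : ℝ) ^ (-w)) ^ i := by
    funext i; ring
  rw [hfun, ← hval]; exact hg'

/-! ## "if p_{j+1}/p_j < 4 for all j < j₀ then the standard deviation is infinite" -/

/-- Octave model, indexed towards LARGE |y|: q₀ > 0 the probability of the reference octave, q_{n+1} the next octave up; if the probabilities fall
slower than a factor c per octave (q_n < c·q_{n+1}) then the c-weighted series Σ q_n cⁿ — c = 4: the second moment, c = 8: the third absolute moment —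
diverges (its terms increase, so do not tend to zero). [cite: Volkov2018, §IV.F "if p_{j+1}/p_j < 4 for all j < j₀ then the standard deviation is
infinite" and footnote (Berry–Esseen, "< 8")] -/
theorem not_summable_of_ratio_lt (c : ℝ) (hc : 0 < c) (q : ℕ → ℝ) (h0 : 0 < q 0) (hratio : ∀ n, q n < c * q (n + 1)) :
    ¬ Summable (fun n => q n * c ^ n) := by
  have hmono : ∀ n, q 0 ≤ q n * c ^ n := by
    intro n
    induction n with
    | zero => simp
    | succ m ih =>
      have hcm : 0 < c ^ m := pow_pos hc m
      have : q m * c ^ m ≤ q (m + 1) * c ^ (m + 1) := by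
        rw [pow_succ]
        have := hratio m
        nlinarith
      linarith
  intro hs
  have ht := hs.tendsto_atTop_zero
  have : ∀ᶠ n in Filter.atTop, q n * c ^ n < q 0 := by
    exact ht.eventually (gt_mem_nhds h0)
  obtain ⟨n, hn⟩ := this.exists
  exact absurd (hmono n) (not_le.mpr hn)

/-- c = 4: the printed sentence (second moment ⇒ standard deviation infinite). [cite: Volkov2018, §IV.F] -/
theorem variance_infinite_of_ratio_lt_four (q : ℕ → ℝ) (h0 : 0 < q 0) (hratio : ∀ n, q n < 4 * q (n + 1)) :
    ¬ Summable (fun n => q n * 4 ^ n) := not_summable_of_ratio_lt 4 (by norm_num) q h0 hratio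

/-- c = 8: the footnote (third central moment infinite ⇒ Berry–Esseen unusable). [cite: Volkov2018, §IV.F footnote] -/
theorem thirdMoment_infinite_of_ratio_lt_eight (q : ℕ → ℝ) (h0 : 0 < q 0) (hratio : ∀ n, q n < 8 * q (n + 1)) :
    ¬ Summable (fun n => q n * 8 ^ n) := not_summable_of_ratio_lt 8 (by norm_num) q h0 hratio

end

end Literature.MathematicalPhysics.QuantumFieldTheory.Volkov2018
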